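import Literature.NumberTheory.Automorphic.GL2CCuspFormLowestKType
import Literature.NumberTheory.Automorphic.GL2CESHModel
import Literature.NumberTheory.Automorphic.AutomorphicRepDataSplitCenter
import Literature.NumberTheory.Automorphic.GLnCuspidalSpectrumSiegel
import HarnessLib

/-!
# The lowest `K`-type inside a stable subspace: level-`K(𝔫)` highest-weight vectors of clean
# cuspidal `π` on `GL₂` over an imaginary quadratic field

`GL2CCuspFormLowestKType.exists_lowestKType_of_noinv` produces a non-zero `𝔨`-highest-weight vector
of weight `2d + 2` somewhere in `W`.  The Eichler–Shimura–Harder family of level `K(𝔫)` needs it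
INSIDE the `K(𝔫)`-fixed vectors.  Since the six operators are archimedean they preserve the
`K(𝔫)`-fixed subspace (`preserves_levelFixed`: right translations by `K(𝔫) = {1} × K_f(𝔫)` commute
with the Lie derivatives), and the lowest-`K`-type theorem runs inside any non-zero stable subspace
(`GL2CKType.Ops.exists_isHW_two_mul_mem`: the hypotheses — unitarity, Casimir scalars,
`𝔨`-finiteness, no invariants — restrict):

* `exists_lowestKType_mem_of_noinv` — **for a non-zero `K(𝔫)`-fixed `v ∈ W` there is a non-zero
  `K(𝔫)`-fixed `𝔨`-highest-weight vector `w ∈ W` of weight `2d + 2`** (`d = λ_{σ₀,0} − λ_{σ₀,1}`), and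
  both Casimir scalars are `½ d(d+2)`. [cite: Harder1987, §3.1 (3.1.3)–(3.1.5)]

Theorems only (and the submodule `levelFixed`); no named fact.
-/

noncomputable section

-- Mathlib idiom (Mathlib/Algebra/Lie/OfAssociative.lean), as in `GL2CCuspFormLowestKType`.
attribute [local instance 100] LieRing.ofAssociativeRing

open scoped Matrix ComplexConjugate Classical
open Complex NumberField NumberField.mixedEmbedding NumberField.InfinitePlace IsDedekindDomain
open _root_.MeasureTheory _root_.MeasureTheory.Measure

namespace Literature.NumberTheory.Automorphic

/-! ### The lowest `K`-type theorem inside a stable subspace -/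

namespace GL2CKType

namespace Ops

variable {C : Type*} [AddCommGroup C] [Module ℂ C] {O : Ops C}

/-- **The lowest `K`-type inside a stable subspace.**  Under the hypotheses of
`exists_isHW_two_mul` (unitarity for a positive form, `Ω_L = Ω_R = ½(p² − 1)`, `𝔨`-finiteness, no
invariants), every non-zero vector of a subspace `S` stable under the six operators yields a non-zero
`𝔨`-highest-weight vector of weight `2p` IN `S`. [cite: Harder1987, §3.1 (3.1.3)–(3.1.5)] -/
theorem exists_isHW_two_mul_mem {ip : C → C → ℂ} (hip : Kuga.IsPosForm ip) (hO : O.IsLawful)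
    (hE : ∀ x y, ip (O.LE x) y = -ip x (O.RE y))
    (hF : ∀ x y, ip (O.LF x) y = -ip x (O.RF y))
    (hH : ∀ x y, ip (O.LH x) y = -ip x (O.RH y))
    {p : ℕ} (hp : 1 ≤ p)
    (hcL : ∀ v, O.casL v = ((((p : ℝ) ^ 2 - 1) / 2 : ℝ) : ℂ) • v)
    (hcR : ∀ v, O.casR v = ((((p : ℝ) ^ 2 - 1) / 2 : ℝ) : ℂ) • v)
    (hfin : ∀ v : C, ∃ S : Submodule ℂ C, v ∈ S ∧ FiniteDimensional ℂ S ∧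
      (∀ x ∈ S, O.Ek x ∈ S) ∧ (∀ x ∈ S, O.Fk x ∈ S) ∧ (∀ x ∈ S, O.Hk x ∈ S))
    (hnoinv : ∀ v : C, O.LE v = 0 → O.LF v = 0 → O.LH v = 0 → O.RE v = 0 → O.RF v = 0 →
      O.RH v = 0 → v = 0)
    {S : Submodule ℂ C} (hS : O.Preserves S) {v : C} (hvS : v ∈ S) (hv : v ≠ 0) :
    ∃ w ∈ S, w ≠ 0 ∧ O.IsHW w ((2 * p : ℕ) : ℂ) := by
  -- the restricted data
  set O' : Ops S := O.restrict hS with hO'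
  have hip' : Kuga.IsPosForm (fun x y : S => ip x y) :=
    { add_left := fun x y z => hip.add_left x y z
      smul_left := fun c x y => hip.smul_left c x y
      conj_symm := fun x y => hip.conj_symm x y
      nonneg := fun x => hip.nonneg x
      definite := fun x hx => Subtype.ext (hip.definite x hx) }
  have hO'l : O'.IsLawful := hO.restrict hS
  have hE' : ∀ x y : S, ip (O'.LE x) y = -ip x (O'.RE y) := fun x y => hE x y
  have hF' : ∀ x y : S, ip (O'.LF x) y = -ip x (O'.RF y) := fun x y => hF x y
  have hH' : ∀ x y : S, ip (O'.LH x) y = -ip x (O'.RH y) := fun x y => hH x y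
  have hcL' : ∀ v : S, O'.casL v = ((((p : ℝ) ^ 2 - 1) / 2 : ℝ) : ℂ) • v := fun v =>
    Subtype.ext (by rw [restrict_casL, Submodule.coe_smul]; exact hcL v)
  have hcR' : ∀ v : S, O'.casR v = ((((p : ℝ) ^ 2 - 1) / 2 : ℝ) : ℂ) • v := fun v =>
    Subtype.ext (by rw [restrict_casR, Submodule.coe_smul]; exact hcR v)
  have hfin' : ∀ v : S, ∃ S' : Submodule ℂ S, v ∈ S' ∧ FiniteDimensional ℂ S' ∧
      (∀ x ∈ S', O'.Ek x ∈ S') ∧ (∀ x ∈ S', O'.Fk x ∈ S') ∧ (∀ x ∈ S', O'.Hk x ∈ S') := by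
    intro v
    obtain ⟨S₀, hv₀, hfd, hES, hFS, hHS⟩ := hfin v
    haveI := hfd
    refine ⟨S₀.comap S.subtype, hv₀, ?_, fun x hx => hES _ hx, fun x hx => hFS _ hx, fun x hx => hHS _ hx⟩
    -- finite-dimensional: injects into `S₀`
    let f : S₀.comap S.subtype →ₗ[ℂ] S₀ := (S.subtype.comp (S₀.comap S.subtype).subtype).codRestrict S₀
      fun x => x.2
    exact Module.Finite.of_injective f fun x y hxy => Subtype.ext (Subtype.ext (congrArg (fun z : S₀ => (z : C)) hxy))
  have hnoinv' : ∀ v : S, O'.LE v = 0 → O'.LF v = 0 → O'.LH v = 0 → O'.RE v = 0 → O'.RF v = 0 →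
      O'.RH v = 0 → v = 0 := fun v h1 h2 h3 h4 h5 h6 =>
    Subtype.ext (hnoinv v (congrArg Subtype.val h1) (congrArg Subtype.val h2) (congrArg Subtype.val h3)
      (congrArg Subtype.val h4) (congrArg Subtype.val h5) (congrArg Subtype.val h6))
  have hv' : (⟨v, hvS⟩ : S) ≠ 0 := fun h => hv (congrArg Subtype.val h)
  obtain ⟨w, hw0, hw⟩ := exists_isHW_two_mul hip' hO'l hE' hF' hH' hp hcL' hcR' hfin' hnoinv' hv'
  refine ⟨w, w.2, fun h => hw0 (Subtype.ext h), ⟨?_, ?_⟩⟩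
  · have := congrArg Subtype.val hw.ek; rwa [restrict_Ek] at this
  · have := congrArg Subtype.val hw.hk; rwa [restrict_Hk, Submodule.coe_smul] at this

end Ops

end GL2CKType

/-! ### The `K(𝔫)`-fixed vectors of `W` -/

namespace GL2CCuspForm

open AutomorphicRepData GL2CKType GLnComplexCasimir ImaginaryQuadratic
open Literature.NumberTheory.DiophantineGeometry Literature.Barriers.Langlands

variable {K : Type} [Field K] [NumberField K] [IsTotallyComplex K]
  {hcpt : isCompact_glFiniteIntegralLevel 2 K} (π : AutomorphicRepData (AutomorphyDatum.gl 2 K hcpt))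

/-- **The `K(𝔫)`-fixed vectors of `W`.** [cite: BorelJacquet1979, §4.2] -/
def levelFixed (𝔫 : Ideal (𝓞 K)) : Submodule ℂ π.W where
  carrier := {φ | ∀ u ∈ principalCongruenceLevel 2 K 𝔫,
    rightTranslation (AdelicGroupData.gl 2 K) u (φ : (AdelicGroupData.gl 2 K).Adelic → ℂ) = φ}
  zero_mem' u _ := by ext g; rfl
  add_mem' {a b} ha hb u hu := by
    rw [Submodule.coe_add, map_add, ha u hu, hb u hu]
  smul_mem' c a ha u hu := by
    rw [Submodule.coe_smul, map_smul, ha u hu]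

omit [IsTotallyComplex K] in
/-- Membership. [folklore] -/
theorem mem_levelFixed {𝔫 : Ideal (𝓞 K)} {φ : π.W} :
    φ ∈ levelFixed π 𝔫 ↔ ∀ u ∈ principalCongruenceLevel 2 K 𝔫,
      rightTranslation (AdelicGroupData.gl 2 K) u (φ : (AdelicGroupData.gl 2 K).Adelic → ℂ) = φ := Iff.rfl

omit [IsTotallyComplex K] in
/-- Elements of `K(𝔫)` (`𝔫 ≠ 0`) are finite-adelic: `{1} × K_f(𝔫)`. [cite: BorelJacquet1979, §4.1] -/
theorem exists_ofFinite_of_mem_principalCongruenceLevel {𝔫 : Ideal (𝓞 K)} (h𝔫 : 𝔫 ≠ 0)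
    {u : GL (Fin 2) (AdeleRing (𝓞 K) K)} (hu : u ∈ principalCongruenceLevel 2 K 𝔫) :
    ∃ u₀, GLn.ofFinite 2 K u₀ = u :=
  le_range_ofFinite_of_mem_finiteLevelsGL (principalCongruenceLevel_mem_finiteLevelsGL_holds 2 K h𝔫) hu

omit [IsTotallyComplex K] in
/-- **The Lie derivatives preserve the `K(𝔫)`-fixed vectors** (`K(𝔫)` commutes with `G_∞`).
[cite: BorelJacquet1979, §4.1–4.2] -/
theorem lieDerivW_mem_levelFixed {𝔫 : Ideal (𝓞 K)} (h𝔫 : 𝔫 ≠ 0) (X : (AutomorphyDatum.gl 2 K hcpt).arch.lie)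
    {φ : π.W} (hφ : φ ∈ levelFixed π 𝔫) : π.lieDerivW X φ ∈ levelFixed π 𝔫 := by
  intro u hu
  obtain ⟨u₀, rfl⟩ := exists_ofFinite_of_mem_principalCongruenceLevel h𝔫 hu
  change rightTranslation (AdelicGroupData.gl 2 K) (GLn.ofFinite 2 K u₀)
    (lieDeriv (AutomorphyDatum.gl 2 K hcpt).ofArch X (φ : (AdelicGroupData.gl 2 K).Adelic → ℂ)) = _
  rw [← lieDeriv_rightTranslation_of_forall_commute X (fun t =>
    (GLn.commute_ofInfinite_ofFinite _ u₀).eq) (φ : (AdelicGroupData.gl 2 K).Adelic → ℂ), hφ _ hu]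
  rfl

/-- The place operators `ρ(Y)` preserve the `K(𝔫)`-fixed vectors. [folklore] -/
theorem rhoAt_mem_levelFixed (h : π.W' = ⊥)
    {ρ𝔤 : (AutomorphyDatum.gl 2 K hcpt).arch.lie →ₗ⁅ℝ⁆ Module.End ℂ π.Quot} (hρ : π.HasLieAction ρ𝔤)
    {𝔫 : Ideal (𝓞 K)} (h𝔫 : 𝔫 ≠ 0) (Y : Matrix (Fin 2) (Fin 2) ℂ) {φ : π.W} (hφ : φ ∈ levelFixed π 𝔫) :
    rhoAt (π.lieOnW h ρ𝔤) (complexPlace K) Y φ ∈ levelFixed π 𝔫 := by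
  rw [rhoAt_apply, lieOnW_eq_lieDerivW π h hρ]
  exact lieDerivW_mem_levelFixed π h𝔫 _ hφ

/-- **The six operators preserve the `K(𝔫)`-fixed vectors.** [cite: Harder1987, §3.1] -/
theorem preserves_levelFixed (h : π.W' = ⊥)
    {ρ𝔤 : (AutomorphyDatum.gl 2 K hcpt).arch.lie →ₗ⁅ℝ⁆ Module.End ℂ π.Quot} (hρ : π.HasLieAction ρ𝔤)
    {𝔫 : Ideal (𝓞 K)} (h𝔫 : 𝔫 ≠ 0) : (opsW π h ρ𝔤).Preserves (levelFixed π 𝔫) := by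
  have hL : ∀ Z, ∀ φ ∈ levelFixed π 𝔫,
      (ofRho (rhoAt (π.lieOnW h ρ𝔤) (complexPlace K))).toFun (AlgHom.id ℝ ℂ) Z φ ∈ levelFixed π 𝔫 := by
    intro Z φ hφ
    rw [GL2CKType.L_apply]
    exact Submodule.smul_mem _ _ (Submodule.sub_mem _ (rhoAt_mem_levelFixed π h hρ h𝔫 Z hφ)
      (Submodule.smul_mem _ _ (rhoAt_mem_levelFixed π h hρ h𝔫 _ hφ)))
  have hR : ∀ Z, (Complex.conjAe : ℂ →ₐ[ℝ] ℂ).mapMatrix Z = Z → ∀ φ ∈ levelFixed π 𝔫,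
      (ofRho (rhoAt (π.lieOnW h ρ𝔤) (complexPlace K))).toFun (Complex.conjAe : ℂ →ₐ[ℝ] ℂ) Z φ ∈ levelFixed π 𝔫 := by
    intro Z hZ φ hφ
    rw [GL2CKType.R_apply _ hZ]
    exact Submodule.smul_mem _ _ (Submodule.add_mem _ (rhoAt_mem_levelFixed π h hρ h𝔫 Z hφ)
      (Submodule.smul_mem _ _ (rhoAt_mem_levelFixed π h hρ h𝔫 _ hφ)))
  exact ⟨hL mE, hL mF, hL mH, hR mE mapMatrix_conj_mE, hR mF mapMatrix_conj_mF, hR mH mapMatrix_conj_mH⟩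

/-- **The lowest `K`-type at level `K(𝔫)`.**  Under the hypotheses of
`exists_lowestKType_of_noinv` (clean cuspidal `π` on `GL₂` over an imaginary quadratic field with
cohomological `a`-exponents of the dual weights, no six-operator invariants), for every `𝔫 ≠ 0` and
every non-zero `K(𝔫)`-fixed `v ∈ W`: both Casimir scalars are `½ d(d+2)` (`d = λ_{σ₀,0} − λ_{σ₀,1}`)
and there is a non-zero `K(𝔫)`-FIXED `𝔨`-highest-weight vector of weight `2d + 2`.
[cite: Harder1987, §3.1 (3.1.3)–(3.1.5)] -/
theorem exists_lowestKType_mem_of_noinv (h : π.W' = ⊥)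
    {ρ𝔤 : (AutomorphyDatum.gl 2 K hcpt).arch.lie →ₗ⁅ℝ⁆ Module.End ℂ π.Quot} (hρ : π.HasLieAction ρ𝔤)
    {lam : (K →+* ℂ) → Fin 2 → ℤ} {T : InfinityType K 2}
    (hχ : Literature.NumberTheory.Automorphic.HasArchParameter
      (ρ𝔤.comp (LieSubalgebra.topEquiv :
        (⊤ : LieSubalgebra ℝ (Matrix (Fin 2) (Fin 2) (mixedSpace K))) ≃ₗ⁅ℝ⁆
          Matrix (Fin 2) (Fin 2) (mixedSpace K)).symm.toLieHom) fun σ => (T σ).map ArchWeight.a)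
    (hTa : ∀ τ : K →+* ℂ, (T τ).map ArchWeight.a =
      (cohomologicalInfinityType 2 K (Weight.dual (lam τ)) τ).map ArchWeight.a)
    (hdom : ∀ τ, Weight.IsDominant (lam τ))
    (Tw : UnitaryTwist π) (μ : Measure (AdelicGroupData.gl 2 K).automorphicQuotient)
    [(AdelicGroupData.gl 2 K).IsAutomorphicMeasure μ]
    (hnoinv : ∀ v : π.W, (opsW π h ρ𝔤).LE v = 0 → (opsW π h ρ𝔤).LF v = 0 → (opsW π h ρ𝔤).LH v = 0 →
      (opsW π h ρ𝔤).RE v = 0 → (opsW π h ρ𝔤).RF v = 0 → (opsW π h ρ𝔤).RH v = 0 → v = 0)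
    {𝔫 : Ideal (𝓞 K)} (h𝔫 : 𝔫 ≠ 0) {v : π.W} (hv𝔫 : v ∈ levelFixed π 𝔫) (hv : v ≠ 0) :
    (∀ x, (opsW π h ρ𝔤).casL x =
      ((2 : ℂ)⁻¹ * (((lam σ₀ 0 - lam σ₀ 1).toNat : ℂ) * (((lam σ₀ 0 - lam σ₀ 1).toNat : ℂ) + 2))) • x) ∧
    (∀ x, (opsW π h ρ𝔤).casR x =
      ((2 : ℂ)⁻¹ * (((lam σ₀ 0 - lam σ₀ 1).toNat : ℂ) * (((lam σ₀ 0 - lam σ₀ 1).toNat : ℂ) + 2))) • x) ∧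
    ∃ w ∈ levelFixed π 𝔫, w ≠ 0 ∧ (opsW π h ρ𝔤).IsHW w ((2 * (lam σ₀ 0 - lam σ₀ 1).toNat + 2 : ℕ) : ℂ) := by
  obtain ⟨hL, hRd, -⟩ := exists_lowestKType_of_noinv π h hρ hχ hTa hdom Tw μ hnoinv
  refine ⟨hL, hRd, ?_⟩
  set d := (lam σ₀ 0 - lam σ₀ 1).toNat with hd
  have hO := isLawful_opsW π h ρ𝔤
  have hip := Tw.isPosForm_pet μ
  obtain ⟨hE, hF, hH⟩ := opsW_adjoint π h hρ Tw μ
  have hfin := kFinite_opsW π h hρ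
  have hcL : ∀ x, (opsW π h ρ𝔤).casL x = (((((d + 1 : ℕ) : ℝ) ^ 2 - 1) / 2 : ℝ) : ℂ) • x := fun x => by
    rw [hL x, half_mul_eq]
  have hcR : ∀ x, (opsW π h ρ𝔤).casR x = (((((d + 1 : ℕ) : ℝ) ^ 2 - 1) / 2 : ℝ) : ℂ) • x := fun x => by
    rw [hRd x, half_mul_eq]
  obtain ⟨w, hw𝔫, hw0, hw⟩ := Ops.exists_isHW_two_mul_mem hip hO hE hF hH (Nat.le_add_left 1 d) hcL hcR hfin hnoinv
    (preserves_levelFixed π h hρ h𝔫) hv𝔫 hv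
  refine ⟨w, hw𝔫, hw0, ?_⟩
  have : 2 * (d + 1) = 2 * d + 2 := by ring
  rwa [this] at hw

end GL2CCuspForm

end Literature.NumberTheory.Automorphic

end
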